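import Summits.NavierStokesRegularity.NavierStokesRegularity.Theorems.NoOverheating.Negative.ExcludedStrataCensusV6
import Summits.NavierStokesRegularity.NavierStokesRegularity.Theorems.NoOverheating.Negative.TransversalComponentsWindowsExcluded
import Summits.NavierStokesRegularity.NavierStokesRegularity.Theorems.NoOverheating.Negative.ScrewPeriodicWindowsExcluded

/-!
# KJ-56 — CENSUS v7 of the excluded strata of route `AngularGalerkinLadder`'s window sequences
# ((S0)–(S14) of `excludedStrata_windowSequences_v6` + (S15) transversal velocity and (S16)
# transversal vorticity bounded near the origin along the precession axis + (S17) a window slice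
# with screw-monotone norm)

Refuter lineage, Negative lane of crux K2 `NoOverheating` (supports, does not decide).  Pure
assembly — this file proves NOTHING new: it folds kernel rows KJ-55a/b and KJ-57 into the census
statement of record, `excludedStrata_windowSequences_v7`, "what an admissible window sequence of K2
can NOT be":

* (S15) the TWO-VELOCITY-COMPONENTS corner (Bae–Choe / Kukavica–Rusin–Ziane read on the ladder):
  some profile `uₙ` keeps its velocity at bounded distance from an `Rₙ`-invariant line `ℝe`
  (`Rₙ e = e ∨ Rₙ e = −e`: `e` on the rotation axis of `Rₙ` or of `−Rₙ`, or `e = 0`) on a backward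
  parabolic cylinder at the space–time origin,
  `∃ ρ > 0, ∃ M, ∀ (t, x) ∈ Q_ρ(0,0), ∃ a, ‖uₙ(t, x) − a e‖ ≤ M` — in coordinates with `e = e₃`:
  `u₁, u₂` bounded near the origin, `u₃` free — excluded for a SINGLE profile by
  `AngularGalerkinLadderTransversalComponentsExcluded.no_windowProfile_transversalVelocityBounded`
  (the distance to the axis scales by `c⁻¹` across one period, so the bound self-improves to
  `uₙ ∥ e` everywhere; a unidirectional divergence-free slice is translation invariant along `e`
  and Type-I decay kills it); `e = 0` is (S11a);
* (S16) the TWO-VORTICITY-COMPONENTS corner (Chae–Choe 1999 read on the ladder): the same with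
  `curl uₙ` in place of `uₙ` (`ω₁, ω₂` bounded near the origin, `ω₃` free) — excluded by
  `no_windowProfile_transversalVorticityBounded` (scaling `c⁻²`; line-parallel slice vorticity is
  (S12)); `e = 0` is (S14);
* (S17) the monotone sharpening of (S10) (helical / periodic / screw symmetry,
  Mahalov–Titi–Leibovich read on the ladder): some profile's window slice has its pointwise norm
  NON-DECREASING under one screw displacement with non-zero advance along its axis,
  `∃ S b, S b = b ≠ 0 ∧ ∀ x, ‖uₙ(−1, x)‖ ≤ ‖uₙ(−1, S x + b)‖` — excluded by Type-I spatial decay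
  alone, `AngularGalerkinLadderScrewPeriodicExcluded.no_windowProfile_screwMonotone_slice`; (S10)
  is the case of equality.

Census sentence after v7: an admissible K2 window sequence compatible with K1 needs `C₀ > ε₀` and
cofinally many singular rungs whose window profile is in NO stratum (S0)–(S17); in particular every
profile has velocity AND vorticity unbounded on every `Q_ρ(0,0)` (S11a), (S14), and even their
components TRANSVERSAL to the precession axis of its own `Rₙ` unbounded there (S15), (S16); no
symmetry with unbounded orbits (S1), (S10), not even a screw-monotone window slice (S17), no
modulus for its vorticity directions (S9), (S13), no line-parallel slice vorticity (S12),
unbounded `L³` slices along the sequence (S7), tails not uniformly `o(1/|x|)` (S8), no usable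
rotation power / hidden scaling (S2)–(S6).  Booked, not claimed: the ONE-component corner (axial
component `⟪uₙ, e⟫` bounded near the origin) self-improves to an axial-free rung flow, for which no
kinematic exclusion is known.
[cite: BaeChoe2007CPDE, main theorem (two velocity components; quoted in Beirão da Veiga 2017, arXiv:1612.07051 p. 2)]
[cite: ChaeChoe1999, Thm. 1 and Remark 1 (p. 2)]
[cite: MahalovTitiLeibovich1990, Thm. 3.3 (global strong helical solutions; quoted in Robinson–Rodrigo–Sadowski 2016, p. 112)] -/

namespace Summit.NavierStokesRegularity.AngularGalerkinLadderExcludedStrataCensusV7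

open Set Filter MeasureTheory Topology Function
open scoped ENNReal
open Literature.Analysis Literature.Analysis.FluidPDE
open Summit.NavierStokesRegularity.FluidComputer
open Summit.NavierStokesRegularity.NavierStokesRegularity.Theses.AngularGalerkinLadder
open Summit.NavierStokesRegularity.AngularGalerkinLadderExcludedStrataCensusV6
open Summit.NavierStokesRegularity.AngularGalerkinLadderTransversalComponentsExcluded
open Summit.NavierStokesRegularity.AngularGalerkinLadderScrewPeriodicExcluded

/-- **Census theorem v7: the excluded strata (S0)–(S17) of K2's window sequences.**  As
`excludedStrata_windowSequences_v6`, plus (S15)/(S16): some profile whose velocity, resp.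
vorticity, stays at bounded distance from an `Rₙ`-invariant line on a backward parabolic cylinder
`Q_ρ(0,0)` at the space–time origin, plus (S17): some profile whose window slice has screw-monotone
norm — for ANY window `1 < cmin ≤ cmax` and ANY rotations.
[cite: BaeChoe2007CPDE, main theorem (two velocity components; quoted in Beirão da Veiga 2017, arXiv:1612.07051 p. 2)] -/
theorem excludedStrata_windowSequences_v7 :
    ∃ ε₀ : ℝ, 0 < ε₀ ∧ ∀ C₀ : ℝ, ∃ κ α₁ c₁ α₂ c₂ lam₁ β₁ β₂ : ℝ,
      1 < κ ∧ 0 < α₁ ∧ 1 < c₁ ∧ 0 < α₂ ∧ 1 < c₂ ∧ 1 < lam₁ ∧ 0 < β₁ ∧ 0 < β₂ ∧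
      ∀ {cmin cmax δ : ℝ} {L : ℕ → ℕ} {ε c : ℕ → ℝ}
        {R : ℕ → (EuclideanSpace ℝ (Fin 3) ≃ₗᵢ[ℝ] EuclideanSpace ℝ (Fin 3))}
        {u : ℕ → ℝ → EuclideanSpace ℝ (Fin 3) → EuclideanSpace ℝ (Fin 3)}
        {p : ℕ → ℝ → EuclideanSpace ℝ (Fin 3) → ℝ}
        {d : ℕ → ℝ → EuclideanSpace ℝ (Fin 3) → EuclideanSpace ℝ (Fin 3)},
        1 < cmin → 0 < δ → Tendsto ε atTop (𝓝 0) →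
        (∀ n, AngularLadder.IsWindowProfile (L n) C₀ cmin cmax δ (ε n) (c n) (R n) (u n) (p n)
          (d n)) →
        ¬ (C₀ ≤ ε₀ ∨
           (∀ n, ∀ t < 0, IsAxisymmetric (u n t)) ∨
           (∃ q : ℕ, 0 < q ∧ cmax ^ q < κ ∧
              ∀ x, Tendsto (fun n => ((R n) ^ q) x) atTop (𝓝 x)) ∨
           (∃ (q : ℕ) (g : ℕ → (EuclideanSpace ℝ (Fin 3) ≃ₗᵢ[ℝ] EuclideanSpace ℝ (Fin 3)))
              (θ : ℕ → ℝ),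
              0 < q ∧ cmax ^ q < c₁ ∧ (∀ n x, ((R n) ^ q) x = g n (rotZ (θ n) ((g n).symm x))) ∧
              ∀ n, |θ n| ≤ 2 * α₁ * (q * Real.log (c n))) ∨
           (∃ (Θ ℓ : ℝ) (g : ℕ → (EuclideanSpace ℝ (Fin 3) ≃ₗᵢ[ℝ] EuclideanSpace ℝ (Fin 3)))
              (θ : ℕ → ℝ),
              ℓ < Real.log c₂ ∧ (∀ n x, R n x = g n (rotZ (θ n) ((g n).symm x))) ∧
              (∀ n, |θ n| ≤ Θ) ∧ (∀ n, 2 * α₂ * Real.log (c n) ≤ |θ n|) ∧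
              ∀ n, (1 + (θ n / (2 * Real.log (c n))) ^ 2) * Real.log (c n) ≤ ℓ) ∨
           (∃ lam : ℝ, 1 < lam ∧ lam < lam₁ ∧ ∀ n, IsDiscretelySelfSimilar lam (u n)) ∨
           (∀ n, IsSelfSimilar (u n)) ∨
           (∃ (g : ℕ → (EuclideanSpace ℝ (Fin 3) ≃ₗᵢ[ℝ] EuclideanSpace ℝ (Fin 3))) (α : ℕ → ℝ),
              (∀ n (μ : ℝ), 1 < μ → IsRotatedDSS μ
                (((g n).symm.trans (rotZLIE (2 * α n * Real.log μ))).trans (g n)) (u n)) ∧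
              ∀ n, |α n| ≤ β₁ ∨ β₂ ≤ |α n|) ∨
           (∃ M : ℝ≥0∞, M < ⊤ ∧ ∀ n, eLpNorm (u n (-1)) 3 volume ≤ M) ∨
           (∃ M : ℝ≥0∞, M < ⊤ ∧ ∀ n, eLpNorm (u n (-1)) 2 volume ≤ M) ∨
           (∀ η : ℝ, 0 < η → ∃ ρ : ℝ, ∀ n x, ρ ≤ ‖x‖ → ‖x‖ * ‖u n (-1) x‖ ≤ η) ∨
           (∀ n, ∀ t < 0, ∃ e : EuclideanSpace ℝ (Fin 3), ∀ x,
              curl (u n t) x = ‖curl (u n t) x‖ • e) ∨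
           (∀ n, ∃ (d₀ : ℝ) (η : ℝ → ℝ), Tendsto η (𝓝[>] 0) (𝓝 0) ∧
              ∀ s ∈ Ioo (-1 : ℝ) 0, ∀ x y, d₀ < ‖curl (u n s) x‖ → d₀ < ‖curl (u n s) y‖ →
                ‖vorticityDirection (curl (u n s)) x - vorticityDirection (curl (u n s)) y‖ ≤
                  η ‖x - y‖) ∨
           (∃ (n : ℕ) (S : EuclideanSpace ℝ (Fin 3) ≃ₗᵢ[ℝ] EuclideanSpace ℝ (Fin 3))
              (b : EuclideanSpace ℝ (Fin 3)), S b = b ∧ b ≠ 0 ∧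
              ∀ x, ‖u n (-1) (S x + b)‖ = ‖u n (-1) x‖) ∨
           (∃ (n : ℕ) (ρ B : ℝ), 0 < ρ ∧
              ∀ z ∈ parabolicCylinder ρ (0 : ℝ × EuclideanSpace ℝ (Fin 3)), ‖u n z.1 z.2‖ ≤ B) ∨
           (∃ (n : ℕ) (U : EuclideanSpace ℝ (Fin 3) → EuclideanSpace ℝ (Fin 3)),
              Continuous U ∧ ∀ t < 0, u n t = U) ∨
           (∃ (n : ℕ) (e : EuclideanSpace ℝ (Fin 3)), ∀ x, ∃ a : ℝ,
              curl (u n (-1)) x = a • e) ∨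
           (∃ (n : ℕ) (d₀ : ℝ) (η : ℝ → ℝ), Tendsto η (𝓝[>] 0) (𝓝 0) ∧
              ∀ s ∈ Ioo (-1 : ℝ) 0, ∀ x y, d₀ < ‖curl (u n s) x‖ → d₀ < ‖curl (u n s) y‖ →
                min ‖vorticityDirection (curl (u n s)) x - vorticityDirection (curl (u n s)) y‖
                    ‖vorticityDirection (curl (u n s)) x + vorticityDirection (curl (u n s)) y‖ ≤
                  η ‖x - y‖) ∨
           (∃ (n : ℕ) (ρ M : ℝ), 0 < ρ ∧
              ∀ z ∈ parabolicCylinder ρ (0 : ℝ × EuclideanSpace ℝ (Fin 3)),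
                ‖curl (u n z.1) z.2‖ ≤ M) ∨
           (∃ (n : ℕ) (e : EuclideanSpace ℝ (Fin 3)) (ρ M : ℝ), (R n e = e ∨ R n e = -e) ∧
              0 < ρ ∧ ∀ z ∈ parabolicCylinder ρ (0 : ℝ × EuclideanSpace ℝ (Fin 3)),
                ∃ a : ℝ, ‖u n z.1 z.2 - a • e‖ ≤ M) ∨
           (∃ (n : ℕ) (e : EuclideanSpace ℝ (Fin 3)) (ρ M : ℝ), (R n e = e ∨ R n e = -e) ∧
              0 < ρ ∧ ∀ z ∈ parabolicCylinder ρ (0 : ℝ × EuclideanSpace ℝ (Fin 3)),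
                ∃ a : ℝ, ‖curl (u n z.1) z.2 - a • e‖ ≤ M) ∨
           (∃ (n : ℕ) (S : EuclideanSpace ℝ (Fin 3) ≃ₗᵢ[ℝ] EuclideanSpace ℝ (Fin 3))
              (b : EuclideanSpace ℝ (Fin 3)), S b = b ∧ b ≠ 0 ∧
              ∀ x, ‖u n (-1) x‖ ≤ ‖u n (-1) (S x + b)‖)) := by
  obtain ⟨ε₀, hε₀, H⟩ := excludedStrata_windowSequences_v6
  refine ⟨ε₀, hε₀, fun C₀ => ?_⟩
  obtain ⟨κ, α₁, c₁, α₂, c₂, lam₁, β₁, β₂, hκ, hα₁, hc₁, hα₂, hc₂, hlam₁, hβ₁, hβ₂, HC⟩ := H C₀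
  refine ⟨κ, α₁, c₁, α₂, c₂, lam₁, β₁, β₂, hκ, hα₁, hc₁, hα₂, hc₂, hlam₁, hβ₁, hβ₂,
    fun {cmin cmax δ L ε c R u p d} hcmin hδ hε hW => ?_⟩
  have HC' := HC hcmin hδ hε hW
  simp only [not_or] at HC' ⊢
  obtain ⟨h0, h1, h2, h3, h4, h5, h6, h7, h8, h9, h10, h11, h12, h13, h14, h15, h16, h17, h18⟩ :=
    HC'
  exact ⟨h0, h1, h2, h3, h4, h5, h6, h7, h8, h9, h10, h11, h12, h13, h14, h15, h16, h17, h18,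
    fun ⟨n, e, ρ, M, hRe, hρ, hM⟩ =>
      no_windowProfile_transversalVelocityBounded hδ (hW n) hRe hρ hM,
    fun ⟨n, e, ρ, M, hRe, hρ, hM⟩ =>
      no_windowProfile_transversalVorticityBounded hδ (hW n) hRe hρ hM,
    fun ⟨n, S, b, hSb, hb, hmono⟩ => no_windowProfile_screwMonotone_slice hδ (hW n) S hSb hb hmono⟩

end Summit.NavierStokesRegularity.AngularGalerkinLadderExcludedStrataCensusV7
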